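import Mathlib
import HarnessLib
import Summits.CriticalPhenomena.SAWScalingLimit.Theorems.SAWSpinMonotoneQCIdentificationDefs
import Summits.CriticalPhenomena.SAWScalingLimit.Theorems.SAWSpinMonotoneQCIdentificationNoBranchingAlgebra
import Summits.CriticalPhenomena.SAWScalingLimit.Theorems.SAWSpinMonotoneQCIdentificationNoBranchingCorners
import Summits.CriticalPhenomena.SAWScalingLimit.Theorems.SAWSpinMonotoneQCIdentificationAffineDictionary
import Summits.CriticalPhenomena.SAWScalingLimit.Theorems.SAWSpinMonotoneQCIdentificationNoCollapse
import Summits.CriticalPhenomena.SAWScalingLimit.Theorems.SAWSpinMonotoneQCIdentificationSecondOrderClosedness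

/-!
# The local `8/5`-power of the observable and the circulation bound at one vertex

Helper sub-goal of `stub_rayCondition` (line `eight_fifths_primitive`, crux `QCIdentification`,
stmt-CriticalPhenomena-16772, wave 4): the lattice packaging of Smirnov's primitive
`Φ_δ = ∫ F^{8/5} dz` at ONE vertex.  Namespace of the checked skeleton, sub-namespace `P85`;
vocabulary from `SAWSpinMonotoneQCIdentificationDefs` (`Fobs`, `hexNbr`, `modeSum`), the algebraic
core `…NoBranchingAlgebra` / `…NoBranchingCorners` (namespace `NB`: `omg = ω = e^{2πi/3}`,
`lemma1_mode`, mode inversion `three_mul_fobs : 3 F_k = S + ω^k B`), the affine dictionary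
`…AffineDictionary` / `…NoCollapse` (namespace `Dev`: the Beltrami mode
`belt F v = F(p₀) + ω² F(p₁) + ω F(p₂)`, `NoFoldBoundWith k`, `norm_belt_le`, the triangle `Δ_v` with
vertices `triVert v k` and edges `faceSign v · ω^{k+1}`), and the analysis file
`…SecondOrderClosedness` (namespace `P85`: `circ u = Σ_k ω^k (1 + ω^k u)^{8/5}`,
`p85_norm_circ_le_unif : ‖circ u‖ ≤ 3 · 2^{8/5} ‖u‖²` on the unit disc).

**What.** Let `F = Fobs Λ a` be the critical parafermionic observable of a simply connected
hexagonal domain `Λ` with boundary source `a`, `v ∈ Λ` a vertex with `∂H`-mode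
`S = modeSum F v ≠ 0`, and `a′ = bratio F v := belt F v / S` its **Beltrami ratio**.  Then

* (`p85_port_factor`) the three port values factor EXACTLY as
  `F(p_k) = (S/3) · (1 + ω^k a′)`, `k = 0, 1, 2` (mode inversion + DCS Lemma 1; the exponent of `ω`
  multiplying the Beltrami ratio at port `k` is `+k` for `belt = F₀ + ω²F₁ + ωF₂`);
* (`p85_localPower_pow_five`) for ANY local constant `L` with `L⁵ = (S/3)⁸` the principal-power
  values `f_k := L · (1 + ω^k a′)^{8/5}` are a consistent `8/5`-th power of the ports:
  `f_k⁵ = F(p_k)⁸` (no argument condition: `(z^{8/5})⁵ = z⁸` for every `z`, `cpow_mul_nat`);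
  such `L` exist (`exists_localConst`) and have `‖L‖ = (‖S‖/3)^{8/5}` (`norm_localConst`);
* (`p85_circulation_eq`, `p85_circulation_norm_le`) the circulation of the `f_k` is
  `Σ_k ω^k f_k = L · circ a′`, of norm `≤ 3 · 2^{8/5} · ‖L‖ · ‖a′‖²` whenever `‖a′‖ < 1`; summed
  against the edge vectors of the dual triangle `Δ_v` this is the circulation of the discrete
  1-form `f dz` around `∂Δ_v` up to the unimodular factor `faceSign v · ω` (`sum_mul_edge_eq`,
  `p85_oneForm_circulation_norm_le`);
* the dictionary with the route hypotheses: (K) at constant `k`, `Dev.NoFoldBoundWith k`, gives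
  `‖a′‖ ≤ k` (`p85_norm_bratio_le_of_noFold`; `< 1` under `NoFoldBound`,
  `p85_norm_bratio_lt_one`), and (M) `InteriorFlattening` gives, for every `ε > 0`, a depth
  `R(ε)` beyond which `‖belt F v‖ ≤ ε ‖modeSum F v‖` (`p85_norm_belt_le_of_flat`) and hence
  `‖a′‖ ≤ ε` (`p85_norm_bratio_le_of_flat`);
* (`p85_local`) the packaged lattice statement at one vertex under (K).

Sources: S. Smirnov, *Towards conformal invariance of 2D lattice models*, Proc. ICM 2006
(arXiv:0708.0032) §5.6 (the primitive `∫ F^{1/σ} dz`); H. Duminil-Copin, S. Smirnov, *The connective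
constant of the honeycomb lattice equals `√(2+√2)`*, Ann. of Math. 175 (2012) 1653–1665
(arXiv:1007.0575), Lemma 1.  Everything here is elementary algebra over the landed files.
-/

noncomputable section

open Complex
open Literature.Probability.LatticeModels Literature.Probability.RandomPlanarGeometry.SAW
open Summit.CriticalPhenomena.SAWScalingLimit.Theses.SAWDevelopingMap

namespace Summit.CriticalPhenomena.SAWScalingLimit.Cruxes.QCIdentification.EightFifthsPrimitive

namespace P85

open NB Dev

/-! ### The Beltrami ratio and the exact port factorisation -/

/-- The **Beltrami ratio** of a mid-edge function at a vertex: `a′ = belt F v / modeSum F v`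
(`= ∂̄H/∂H` up to the unimodular constant `cBeta/cAlpha = -ζ`; junk value `0` when `modeSum F v = 0`). -/
def bratio (F : Sym2 HexVertex → ℂ) (v : HexVertex) : ℂ := Dev.belt F v / modeSum F v

/-- `belt = modeSum · bratio` on a non-degenerate face. -/
theorem belt_eq_modeSum_mul_bratio {F : Sym2 HexVertex → ℂ} {v : HexVertex} (hS : modeSum F v ≠ 0) :
    Dev.belt F v = modeSum F v * bratio F v := by
  rw [bratio, mul_div_cancel₀ _ hS]

/-- `‖bratio F v‖ = ‖belt F v‖ / ‖modeSum F v‖`. -/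
theorem norm_bratio (F : Sym2 HexVertex → ℂ) (v : HexVertex) :
    ‖bratio F v‖ = ‖Dev.belt F v‖ / ‖modeSum F v‖ := by
  rw [bratio, norm_div]

/-- **Exact port factorisation.** At a vertex `v ∈ Λ` of a simply connected domain with boundary
source and non-vanishing `∂H`-mode `S`, the three port values are `F(p_k) = (S/3)(1 + ω^k a′)` with
`a′ = bratio` the Beltrami ratio (mode inversion `NB.three_mul_fobs`, i.e. DCS Lemma 1 kills the
third Fourier mode; `Dev.belt = NB.modeBel`). -/
theorem p85_port_factor : ∀ (Λ : Finset HexVertex), hexDomainSimplyConnected Λ → ∀ {a : Sym2 HexVertex}, a ∈ hexDomainBoundary Λ → ∀ {v : HexVertex}, v ∈ Λ → modeSum (Fobs Λ a) v ≠ 0 → ∀ k : Fin 3, Fobs Λ a s(v, hexNbr v k) = modeSum (Fobs Λ a) v / 3 * (1 + NB.omg ^ (k : ℕ) * bratio (Fobs Λ a) v) := by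
  intro Λ hΛ a ha v hv hS k
  have h3 := three_mul_fobs hΛ ha hv k
  rw [← belt_eq_modeBel] at h3
  have key : modeSum (Fobs Λ a) v / 3 * (1 + omg ^ (k : ℕ) * bratio (Fobs Λ a) v) =
      (modeSum (Fobs Λ a) v + omg ^ (k : ℕ) * Dev.belt (Fobs Λ a) v) / 3 := by
    rw [belt_eq_modeSum_mul_bratio hS]
    ring
  rw [key, ← h3]
  ring

/-! ### The local `8/5`-th power -/

/-- `(z^{8/5})⁵ = z⁸` for every complex `z` (principal power; no argument condition). -/
theorem cpow_eight_fifths_pow_five (z : ℂ) : (z ^ ((8 : ℂ) / 5)) ^ 5 = z ^ 8 := by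
  have h : (8 : ℂ) / 5 * ((5 : ℕ) : ℂ) = ((8 : ℕ) : ℂ) := by
    push_cast
    ring
  rw [← cpow_mul_nat, h, cpow_natCast]

/-- **Consistency of the local power, unconditional form.** If `L⁵ = (S/3)⁸` then
`(L (1 + ω^k a′)^{8/5})⁵ = ((S/3)(1 + ω^k a′))⁸`. -/
theorem localPower_pow_five (S a' L : ℂ) (k : Fin 3) (hL : L ^ 5 = (S / 3) ^ 8) :
    (L * (1 + omg ^ (k : ℕ) * a') ^ ((8 : ℂ) / 5)) ^ 5 = ((S / 3) * (1 + omg ^ (k : ℕ) * a')) ^ 8 := by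
  rw [mul_pow, hL, cpow_eight_fifths_pow_five, ← mul_pow]

/-- **Consistency of the local `8/5`-th power (registered form).** For any local constant `L` with
`L⁵ = (S/3)⁸`, the values `f_k = L (1 + ω^k a′)^{8/5}` satisfy `f_k⁵ = ((S/3)(1 + ω^k a′))⁸ = F(p_k)⁸`:
they are a consistent choice of `F^{8/5}` on the three ports of the vertex. -/
theorem p85_localPower_pow_five : ∀ (S a' L : ℂ) (k : Fin 3), ‖a'‖ < 1 → L ^ 5 = (S / 3) ^ 8 → (L * (1 + NB.omg ^ (k : ℕ) * a') ^ ((8 : ℂ) / 5)) ^ 5 = ((S / 3) * (1 + NB.omg ^ (k : ℕ) * a')) ^ 8 :=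
  fun S a' L k _ hL => localPower_pow_five S a' L k hL

/-- Local constants exist: `L := ((S/3)⁸)^{1/5}` has `L⁵ = (S/3)⁸`. -/
theorem exists_localConst (S : ℂ) : ∃ L : ℂ, L ^ 5 = (S / 3) ^ 8 :=
  ⟨((S / 3) ^ 8) ^ ((5 : ℂ)⁻¹), cpow_ofNat_inv_pow _ 5⟩

/-- The norm of a local constant: `L⁵ = (S/3)⁸` forces `‖L‖ = (‖S‖/3)^{8/5}`. -/
theorem norm_localConst {S L : ℂ} (hL : L ^ 5 = (S / 3) ^ 8) : ‖L‖ = (‖S‖ / 3) ^ ((8 : ℝ) / 5) := by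
  have h5 : ‖L‖ ^ 5 = (‖S‖ / 3) ^ 8 := by
    rw [← norm_pow, hL, norm_pow, norm_div]
    norm_num
  have hL0 : 0 ≤ ‖L‖ := norm_nonneg _
  have hS0 : 0 ≤ ‖S‖ / 3 := by positivity
  calc ‖L‖ = (‖L‖ ^ 5) ^ ((5 : ℝ)⁻¹) := by
        rw [← Real.rpow_natCast, ← Real.rpow_mul hL0]
        norm_num
    _ = ((‖S‖ / 3) ^ 8) ^ ((5 : ℝ)⁻¹) := by rw [h5]
    _ = (‖S‖ / 3) ^ ((8 : ℝ) / 5) := by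
        rw [← Real.rpow_natCast, ← Real.rpow_mul hS0]
        norm_num

/-! ### The circulation of the local power -/

/-- **The circulation is `L · circ a′`.** -/
theorem p85_circulation_eq : ∀ (a' L : ℂ), ∑ k : Fin 3, NB.omg ^ (k : ℕ) * (L * (1 + NB.omg ^ (k : ℕ) * a') ^ ((8 : ℂ) / 5)) = L * circ a' := by
  intro a' L
  rw [circ, Finset.mul_sum]
  refine Finset.sum_congr rfl fun k _ => ?_
  ring

/-- **Circulation bound (registered form).** For `‖a′‖ < 1` the circulation of the local `8/5`-th
power `f_k = L (1 + ω^k a′)^{8/5}` is quadratically small in the Beltrami ratio: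
`‖Σ_k ω^k f_k‖ ≤ 3 · 2^{8/5} · ‖L‖ · ‖a′‖²` (second-order closedness `p85_norm_circ_le_unif`). -/
theorem p85_circulation_norm_le : ∀ (a' L : ℂ), ‖a'‖ < 1 → ‖∑ k : Fin 3, NB.omg ^ (k : ℕ) * (L * (1 + NB.omg ^ (k : ℕ) * a') ^ ((8 : ℂ) / 5))‖ ≤ 3 * 2 ^ ((8 : ℝ) / 5) * ‖L‖ * ‖a'‖ ^ 2 := by
  intro a' L ha
  rw [p85_circulation_eq, norm_mul]
  calc ‖L‖ * ‖circ a'‖ ≤ ‖L‖ * (3 * 2 ^ ((8 : ℝ) / 5) * ‖a'‖ ^ 2) :=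
        mul_le_mul_of_nonneg_left (p85_norm_circ_le_unif a' ha) (norm_nonneg _)
    _ = 3 * 2 ^ ((8 : ℝ) / 5) * ‖L‖ * ‖a'‖ ^ 2 := by ring

/-- **The discrete 1-form around `∂Δ_v`.** Summing values `f_k` against the three edge vectors
`triVert v (k+1) - triVert v k = faceSign v · ω^{k+1}` of the dual triangle gives
`faceSign v · ω · Σ_k ω^k f_k`. -/
theorem sum_mul_edge_eq (v : HexVertex) (f : Fin 3 → ℂ) :
    ∑ k : Fin 3, f k * (triEmbed (triVert v (k + 1)) - triEmbed (triVert v k)) =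
      faceSign v * omg * ∑ k : Fin 3, omg ^ (k : ℕ) * f k := by
  rw [Finset.mul_sum]
  refine Finset.sum_congr rfl fun k _ => ?_
  rw [edge_eq, pow_succ]
  ring

/-- `‖faceSign v · ω · X‖ = ‖X‖`. -/
theorem norm_faceSign_mul_omg_mul (v : HexVertex) (X : ℂ) : ‖faceSign v * omg * X‖ = ‖X‖ := by
  rw [norm_mul, norm_mul, norm_faceSign, norm_omg, one_mul, one_mul]

/-- **Circulation of `f dz` around the dual triangle.** For `‖a′‖ < 1` and any `L`, the discrete
1-form `f dz`, `f_k = L (1 + ω^k a′)^{8/5}` on the edge of `Δ_v` crossed by the `k`-th mid-edge, has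
circulation of norm `≤ 3 · 2^{8/5} · ‖L‖ · ‖a′‖²` around `∂Δ_v`. -/
theorem p85_oneForm_circulation_norm_le (v : HexVertex) (a' L : ℂ) (ha : ‖a'‖ < 1) :
    ‖∑ k : Fin 3, (L * (1 + omg ^ (k : ℕ) * a') ^ ((8 : ℂ) / 5)) *
        (triEmbed (triVert v (k + 1)) - triEmbed (triVert v k))‖ ≤
      3 * 2 ^ ((8 : ℝ) / 5) * ‖L‖ * ‖a'‖ ^ 2 := by
  rw [sum_mul_edge_eq, norm_faceSign_mul_omg_mul]
  exact p85_circulation_norm_le a' L ha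

/-! ### The dictionary with the route hypotheses (K) and (M) -/

/-- **(K) bounds the Beltrami ratio**: under `NoFoldBoundWith k`, `‖a′‖ ≤ k` at every
non-degenerate vertex (`Dev.norm_belt_le`). -/
theorem p85_norm_bratio_le_of_noFold : ∀ {k : ℝ}, Dev.NoFoldBoundWith k → ∀ {Λ : Finset HexVertex}, hexDomainSimplyConnected Λ → ∀ {a : Sym2 HexVertex}, a ∈ hexDomainBoundary Λ → ∀ {v : HexVertex}, v ∈ Λ → modeSum (Fobs Λ a) v ≠ 0 → ‖bratio (Fobs Λ a) v‖ ≤ k := by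
  intro k hk Λ hΛ a ha v hv hS
  rw [norm_bratio, div_le_iff₀ (norm_pos_iff.2 hS)]
  exact norm_belt_le hk hΛ ha hv

/-- Under `NoFoldBound` the Beltrami ratio of a non-degenerate vertex lies in the open unit disc. -/
theorem p85_norm_bratio_lt_one : NoFoldBound → ∀ {Λ : Finset HexVertex}, hexDomainSimplyConnected Λ → ∀ {a : Sym2 HexVertex}, a ∈ hexDomainBoundary Λ → ∀ {v : HexVertex}, v ∈ Λ → modeSum (Fobs Λ a) v ≠ 0 → ‖bratio (Fobs Λ a) v‖ < 1 := by
  intro hK Λ hΛ a ha v hv hS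
  obtain ⟨k, hk1, hk⟩ := noFoldBound_iff.1 hK
  exact (p85_norm_bratio_le_of_noFold hk hΛ ha hv hS).trans_lt hk1

/-- **(M) bounds the Beltrami mode at deep vertices (registered form).** `InteriorFlattening`
instantiated at the labelling `(w₀, w₁, w₂) = (hexNbr v 0, hexNbr v 2, hexNbr v 1)` (whose `ω`-mode
is `belt`): for every `ε > 0` there is `R` such that `‖belt F v‖ ≤ ε ‖modeSum F v‖` at every vertex
whose Euclidean `R`-neighbourhood of lattice vertices lies in `Λ`. -/
theorem p85_norm_belt_le_of_flat : InteriorFlattening → ∀ ε : ℝ, 0 < ε → ∃ R : ℝ, ∀ (Λ : Finset HexVertex), hexDomainSimplyConnected Λ → ∀ a ∈ hexDomainBoundary Λ, ∀ v ∈ Λ, (∀ w : HexVertex, dist (hexCenter w) (hexCenter v) ≤ R → w ∈ Λ) → ‖Dev.belt (Fobs Λ a) v‖ ≤ ε * ‖modeSum (Fobs Λ a) v‖ := by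
  intro hM ε hε
  obtain ⟨R, hR⟩ := hM ε hε
  refine ⟨R, fun Λ hΛ a ha v hv hdeep => ?_⟩
  have h := hR Λ hΛ a ha v hv hdeep (hexNbr v 0) (hexNbr v 2) (hexNbr v 1) (adj_hexNbr v 0)
    (adj_hexNbr v 2) (adj_hexNbr v 1) (hexNbr_ne v (by decide)) (hexNbr_ne v (by decide))
    (hexNbr_ne v (by decide))
  simp only at h
  change ‖Fobs Λ a s(v, hexNbr v 0) + omg * Fobs Λ a s(v, hexNbr v 2) +
      omg ^ 2 * Fobs Λ a s(v, hexNbr v 1)‖ ≤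
    ε * ‖Fobs Λ a s(v, hexNbr v 0) + Fobs Λ a s(v, hexNbr v 2) + Fobs Λ a s(v, hexNbr v 1)‖ at h
  have hB : Dev.belt (Fobs Λ a) v =
      Fobs Λ a s(v, hexNbr v 0) + omg * Fobs Λ a s(v, hexNbr v 2) +
        omg ^ 2 * Fobs Λ a s(v, hexNbr v 1) := by
    unfold Dev.belt; ring
  have hS : modeSum (Fobs Λ a) v =
      Fobs Λ a s(v, hexNbr v 0) + Fobs Λ a s(v, hexNbr v 2) + Fobs Λ a s(v, hexNbr v 1) := by
    unfold modeSum; ring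
  rw [hB, hS]
  exact h

/-- **(M) bounds the Beltrami ratio at deep vertices**: `‖a′‖ ≤ ε` beyond depth `R(ε)` (no
non-degeneracy hypothesis: the junk value at `S = 0` is `0`). -/
theorem p85_norm_bratio_le_of_flat : InteriorFlattening → ∀ ε : ℝ, 0 < ε → ∃ R : ℝ, ∀ (Λ : Finset HexVertex), hexDomainSimplyConnected Λ → ∀ a ∈ hexDomainBoundary Λ, ∀ v ∈ Λ, (∀ w : HexVertex, dist (hexCenter w) (hexCenter v) ≤ R → w ∈ Λ) → ‖bratio (Fobs Λ a) v‖ ≤ ε := by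
  intro hM ε hε
  obtain ⟨R, hR⟩ := p85_norm_belt_le_of_flat hM ε hε
  refine ⟨R, fun Λ hΛ a ha v hv hdeep => ?_⟩
  have h := hR Λ hΛ a ha v hv hdeep
  rw [norm_bratio]
  by_cases hS : modeSum (Fobs Λ a) v = 0
  · rw [hS, norm_zero, div_zero]
    exact hε.le
  · rwa [div_le_iff₀ (norm_pos_iff.2 hS)]

/-! ### The packaged lattice statement at one vertex -/

/-- **Local `8/5`-power and circulation bound at one vertex (under (K) at constant `k < 1`).**
At a non-degenerate vertex `v ∈ Λ` (`S = modeSum ≠ 0`) of a simply connected domain with boundary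
source, for every local constant `L` with `L⁵ = (S/3)⁸`, the values `f_k = L (1 + ω^k a′)^{8/5}`
(`a′ = bratio`) satisfy `f_k⁵ = F(p_k)⁸` on the three ports and their circulation has norm
`≤ 3 · 2^{8/5} · ‖L‖ · ‖a′‖²`, with `‖a′‖ ≤ k`. -/
theorem p85_local {k : ℝ} (hk1 : k < 1) (hk : Dev.NoFoldBoundWith k) {Λ : Finset HexVertex}
    (hΛ : hexDomainSimplyConnected Λ) {a : Sym2 HexVertex} (ha : a ∈ hexDomainBoundary Λ)
    {v : HexVertex} (hv : v ∈ Λ) (hS : modeSum (Fobs Λ a) v ≠ 0) {L : ℂ}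
    (hL : L ^ 5 = (modeSum (Fobs Λ a) v / 3) ^ 8) :
    ‖bratio (Fobs Λ a) v‖ ≤ k ∧
    (∀ j : Fin 3, (L * (1 + omg ^ (j : ℕ) * bratio (Fobs Λ a) v) ^ ((8 : ℂ) / 5)) ^ 5 =
      Fobs Λ a s(v, hexNbr v j) ^ 8) ∧
    ‖∑ j : Fin 3, omg ^ (j : ℕ) * (L * (1 + omg ^ (j : ℕ) * bratio (Fobs Λ a) v) ^ ((8 : ℂ) / 5))‖ ≤
      3 * 2 ^ ((8 : ℝ) / 5) * ‖L‖ * ‖bratio (Fobs Λ a) v‖ ^ 2 := by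
  have hb : ‖bratio (Fobs Λ a) v‖ ≤ k := p85_norm_bratio_le_of_noFold hk hΛ ha hv hS
  have hb1 : ‖bratio (Fobs Λ a) v‖ < 1 := hb.trans_lt hk1
  refine ⟨hb, fun j => ?_, p85_circulation_norm_le _ L hb1⟩
  rw [localPower_pow_five _ _ L j hL, ← p85_port_factor Λ hΛ ha hv hS j]

end P85

end Summit.CriticalPhenomena.SAWScalingLimit.Cruxes.QCIdentification.EightFifthsPrimitive

end
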